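import Summits.AtomisticToContinuum.Crystallization.Theorems.ExcessDecayLiouvilleRelaxationCoercive
import Summits.AtomisticToContinuum.Crystallization.Theorems.ExcessDecayLiouvilleLatticeSumConst
import Summits.AtomisticToContinuum.Crystallization.Theorems.ExcessDecayLiouvilleFarField
import Summits.AtomisticToContinuum.Crystallization.Theorems.ExcessDecayLiouvilleCaccioppoliLocalWeights
import Summits.AtomisticToContinuum.Crystallization.Theorems.ExcessDecayLiouvilleFluxPairingSq
import Summits.AtomisticToContinuum.Crystallization.Theorems.ExcessDecayLiouvilleEquationBounds
import Summits.AtomisticToContinuum.Crystallization.Theorems.ExcessDecayLiouvilleDirichletSolve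

/-!
# Route `ExcessDecayLiouville`: optical consistency of the Taylor data, row families (nonlinear half, XIV a)

Harmonic-replacement architecture for item `ExcessDecay` (stmt-AtomisticToContinuum-9334), nonlinear half.
The linear decay step produces an affine-plus-shift Taylor field `T(t m + Az) = a m + B(t m + Az − p₀)` of a
field `h` with ZERO rows near the base site `p₀ = t 0 + A z₀`, with `a 0 = h p₀` and the pointwise error
`‖h x − T x‖ ≤ K dist(x, p₀)²` on the sites of `B_{R_T}(c₀)`.  The linear regularity theory does not
control the inter-sublattice ("optical") jump `a 0 − a 1`; the zero row of `h` at `p₀` does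
(`taylor_jump_le`): splitting the row as `M(a 0 − a 1) + R(B) − Σ_q K(p₀ − q)(h − T)(q) = 0` with the cross
force-constant operator `M` (coercive, `crossFC_coercive`) and `‖R(B)‖ ≤ 38 F₇ ‖B‖`,

`‖a 0 − a 1‖ ≤ (2/κ)(38 S₇ ‖B‖ + 38 S₆ K + 38 F₈(R') Vₐ + 38 F₇(R') ‖B‖ + 38 √F₈(R') √(39 J))`,

`R' = R_T − 11/10`, `Vₐ ≥ ‖a m‖`, `J ≥` the weighted far mass of `h` with floor `R_T` about `c₀`.
All `[folklore]`; helper lemmas, nothing here closes an item.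
-/

noncomputable section

namespace Summit.AtomisticToContinuum.Crystallization.Theorems.ExcessDecayLiouville

open scoped BigOperators Topology InnerProductSpace RealInnerProductSpace Classical
open Literature.MathematicalPhysics.StatisticalMechanics
open Summit.AtomisticToContinuum.Crystallization.Theorems.PhononStabilityNegative

local notation "E3" => EuclideanSpace ℝ (Fin 3)

-- Local notation: the force-constant map `K(e)w = h(|e|²)w + 2⟪e,w⟫h′(|e|²)e` (`= forceConst e w`).
local notation3 "𝕂[" e "] " w:max =>
  (-((‖e‖ ^ 2)⁻¹) ^ 7 + ((‖e‖ ^ 2)⁻¹) ^ 4) • w + (2 * ⟪e, w⟫ * (7 * ((‖e‖ ^ 2)⁻¹) ^ 8 - 4 * ((‖e‖ ^ 2)⁻¹) ^ 5)) • e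

section

variable {t : Fin 2 → E3} {A : E3 →L[ℝ] E3} {κ : ℝ}

set_option quotPrecheck false in
-- Local notation: the operator row `(L v)(p)`.
local notation "𝕃" v:max " @ " p:max =>
  tsum (fun q : Sites₀ t A => (if ((p : Sites₀ t A) : E3) ≠ q then
    𝕂[((p : Sites₀ t A) : E3) - q] (v ((p : Sites₀ t A) : E3) - v q) else 0))
set_option quotPrecheck false in
-- Local notation: the cross force-constant operator `M = Σ'_{q ∈ S₁} K(t 0 − q)`.
local notation "𝐌ₓ" =>
  tsum (fun q : Sites₀ t A => (if (∃ z ∈ Λ₀, (q : E3) = t 1 + A z) then forceConst ((t 0 : E3) - q) else 0))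

/-! ## Two far lattice sums -/

/-- **The far seventh-power lattice sum**: `Σ'_{dist q p > ρ} (dist q p)⁻⁷ ≤ 1024/((23/25)³ ρ⁴)` for
`ρ ≥ 23/25`. [folklore] -/
theorem summable_far_inv_pow_seven_sites (hA : Adm₀ A) (hI : Inner₀ t A) (p : E3) {ρ : ℝ} (hρ : 23 / 25 ≤ ρ) :
    Summable (fun q : Sites₀ t A => if ρ < dist (q : E3) p then (dist (q : E3) p)⁻¹ ^ 7 else 0) ∧
    ∑' q : Sites₀ t A, (if ρ < dist (q : E3) p then (dist (q : E3) p)⁻¹ ^ 7 else 0) ≤ 1024 / ((23 / 25 : ℝ) ^ 3 * ρ ^ 4) := by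
  classical
  have hbound : ∀ u : Finset (Sites₀ t A),
      ∑ q ∈ u, (if ρ < dist (q : E3) p then (dist (q : E3) p)⁻¹ ^ 7 else 0) ≤ 1024 / ((23 / 25 : ℝ) ^ 3 * ρ ^ 4) := by
    intro u
    have hsum : ∑ q ∈ u, (if ρ < dist (q : E3) p then (dist (q : E3) p)⁻¹ ^ 7 else 0) =
        ∑ a ∈ (u.map (Function.Embedding.subtype _)).filter (fun a => ρ < dist a p), (dist a p)⁻¹ ^ (4 + 3) := by
      rw [Finset.sum_filter, Finset.sum_map]
      rfl
    rw [hsum]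
    refine sum_inv_pow_le_of_separated _ p (by norm_num) (by norm_num) hρ ?_ ?_
    · intro a ha b hb hab
      simp only [Finset.mem_filter, Finset.mem_map, Function.Embedding.coe_subtype] at ha hb
      obtain ⟨⟨a', -, rfl⟩, -⟩ := ha
      obtain ⟨⟨b', -, rfl⟩, -⟩ := hb
      exact dist_sites_ge hA hI a'.2 b'.2 hab
    · intro a ha
      simp only [Finset.mem_filter, Finset.mem_map, Function.Embedding.coe_subtype] at ha
      exact ha.2.le
  exact ⟨summable_of_sum_le (fun q => by split_ifs <;> positivity) hbound,
    Real.tsum_le_of_sum_le (fun q => by split_ifs <;> positivity) hbound⟩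

/-- **The sixth-power lattice sum**: `Σ'_{q ≠ p} (dist q p)⁻⁶ ≤ 1024/((23/25)³ (23/25)³)` for a site `p`.
[folklore] -/
theorem summable_inv_pow_six_sites (hA : Adm₀ A) (hI : Inner₀ t A) {p : E3} (hp : p ∈ Sites₀ t A) :
    Summable (fun q : Sites₀ t A => if (q : E3) ≠ p then (dist (q : E3) p)⁻¹ ^ 6 else 0) ∧
    ∑' q : Sites₀ t A, (if (q : E3) ≠ p then (dist (q : E3) p)⁻¹ ^ 6 else 0) ≤
      1024 / ((23 / 25 : ℝ) ^ 3 * (23 / 25 : ℝ) ^ 3) := by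
  classical
  have hbound : ∀ u : Finset (Sites₀ t A),
      ∑ q ∈ u, (if (q : E3) ≠ p then (dist (q : E3) p)⁻¹ ^ 6 else 0) ≤ 1024 / ((23 / 25 : ℝ) ^ 3 * (23 / 25 : ℝ) ^ 3) := by
    intro u
    have hsum : ∑ q ∈ u, (if (q : E3) ≠ p then (dist (q : E3) p)⁻¹ ^ 6 else 0) =
        ∑ a ∈ (u.map (Function.Embedding.subtype _)).filter (· ≠ p), (dist a p)⁻¹ ^ (3 + 3) := by
      rw [Finset.sum_filter, Finset.sum_map]
      rfl
    rw [hsum]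
    refine sum_inv_pow_le_of_separated _ p (by norm_num) (by norm_num) le_rfl ?_ ?_
    · intro a ha b hb hab
      simp only [Finset.mem_filter, Finset.mem_map, Function.Embedding.coe_subtype] at ha hb
      obtain ⟨⟨a', -, rfl⟩, -⟩ := ha
      obtain ⟨⟨b', -, rfl⟩, -⟩ := hb
      exact dist_sites_ge hA hI a'.2 b'.2 hab
    · intro a ha
      simp only [Finset.mem_filter, Finset.mem_map, Function.Embedding.coe_subtype] at ha
      obtain ⟨⟨a', -, rfl⟩, ha2⟩ := ha
      exact dist_sites_ge hA hI a'.2 hp ha2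
  exact ⟨summable_of_sum_le (fun q => by split_ifs <;> positivity) hbound,
    Real.tsum_le_of_sum_le (fun q => by split_ifs <;> positivity) hbound⟩

/-! ## The jump estimate -/

/-- The family `Y q = [p₀ ≠ q] K(p₀ − q)(B(p₀ − q))` of the linear part is summable with
`‖Σ' Y‖ ≤ 38 S₇ ‖B‖`. [folklore] -/
theorem taylorJump_linear_row (hA : Adm₀ A) (hI : Inner₀ t A) {z₀ : E3} (hz₀ : z₀ ∈ Λ₀) (B : E3 →L[ℝ] E3) :
    Summable (fun q : Sites₀ t A =>
      (if (t 0 + A z₀ : E3) ≠ (q : E3) then 𝕂[(t 0 + A z₀ : E3) - (q : E3)] (B ((t 0 + A z₀ : E3) - (q : E3))) else 0)) ∧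
    ‖∑' q : Sites₀ t A,
      (if (t 0 + A z₀ : E3) ≠ (q : E3) then 𝕂[(t 0 + A z₀ : E3) - (q : E3)] (B ((t 0 + A z₀ : E3) - (q : E3))) else 0)‖ ≤
      38 * (1024 / ((23 / 25 : ℝ) ^ 3 * (23 / 25 : ℝ) ^ 4)) * ‖B‖ := by
  have hp₀ : t 0 + A z₀ ∈ Sites₀ t A := add_mem_sites₀ t0_mem_sites hz₀
  obtain ⟨h7s, h7le⟩ := summable_inv_pow_seven_sites hA hI hp₀
  have hYbd : ∀ q : Sites₀ t A, ‖(if (t 0 + A z₀ : E3) ≠ (q : E3) then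
      𝕂[(t 0 + A z₀ : E3) - (q : E3)] (B ((t 0 + A z₀ : E3) - (q : E3))) else 0)‖ ≤
      38 * ‖B‖ * (if (q : E3) ≠ t 0 + A z₀ then (dist (q : E3) (t 0 + A z₀))⁻¹ ^ 7 else 0) := by
    intro q
    by_cases hpq : (t 0 + A z₀ : E3) ≠ q
    · rw [if_pos hpq, if_pos (Ne.symm hpq)]
      have hd := dist_sites_ge hA hI hp₀ q.2 hpq
      have he : 9 / 10 ≤ ‖(t 0 + A z₀ : E3) - q‖ := by rw [← dist_eq_norm]; linarith
      have he0 : 0 < ‖(t 0 + A z₀ : E3) - q‖ := by linarith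
      refine (norm_forceConst_apply_le he _).trans ?_
      rw [dist_comm, dist_eq_norm]
      calc 38 * ‖(t 0 + A z₀ : E3) - q‖⁻¹ ^ 8 * ‖B ((t 0 + A z₀ : E3) - q)‖
          ≤ 38 * ‖(t 0 + A z₀ : E3) - q‖⁻¹ ^ 8 * (‖B‖ * ‖(t 0 + A z₀ : E3) - q‖) := by gcongr; exact B.le_opNorm _
        _ = 38 * ‖B‖ * (‖(t 0 + A z₀ : E3) - q‖⁻¹ ^ 7 * (‖(t 0 + A z₀ : E3) - q‖⁻¹ * ‖(t 0 + A z₀ : E3) - q‖)) := by ring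
        _ = 38 * ‖B‖ * ‖(t 0 + A z₀ : E3) - q‖⁻¹ ^ 7 := by rw [inv_mul_cancel₀ he0.ne', mul_one]
    · rw [if_neg hpq, if_neg (fun h' => hpq (Ne.symm h')), norm_zero, mul_zero]
  refine ⟨Summable.of_norm_bounded (h7s.mul_left (38 * ‖B‖)) hYbd, ?_⟩
  calc _ ≤ ∑' q : Sites₀ t A, 38 * ‖B‖ * (if (q : E3) ≠ t 0 + A z₀ then (dist (q : E3) (t 0 + A z₀))⁻¹ ^ 7 else 0) :=
        tsum_of_norm_bounded (h7s.mul_left (38 * ‖B‖)).hasSum hYbd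
    _ = 38 * ‖B‖ * ∑' q : Sites₀ t A, (if (q : E3) ≠ t 0 + A z₀ then (dist (q : E3) (t 0 + A z₀))⁻¹ ^ 7 else 0) := tsum_mul_left
    _ ≤ 38 * ‖B‖ * (1024 / ((23 / 25 : ℝ) ^ 3 * (23 / 25 : ℝ) ^ 4)) := by gcongr
    _ = _ := by ring

/-- The far mass of `h` against the eighth-power kernel about `p₀`, by Cauchy–Schwarz over the finite
support: `Σ'_{dist q c₀ > R} 38 (dist q p₀)⁻⁸ ‖h q‖ ≤ 38 √F₈(R − 11/10) √(39 J)`. [folklore] -/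
theorem taylorJump_far_mass (hA : Adm₀ A) (hI : Inner₀ t A)
    {h : E3 → E3} (hh : (Function.support h).Finite) {z₀ : E3} {c₀ : E3}
    (hp₀c : dist (t 0 + A z₀) c₀ ≤ 11 / 10) {R J : ℝ} (hR : 3 ≤ R)
    (hJ : ∑' q : Sites₀ t A, ‖h q‖ ^ 2 * (max (dist (q : E3) c₀) R)⁻¹ ^ 8 ≤ J) :
    Summable (fun q : Sites₀ t A =>
      (if R < dist (q : E3) c₀ then 38 * (dist (q : E3) (t 0 + A z₀))⁻¹ ^ 8 * ‖h q‖ else 0)) ∧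
    ∑' q : Sites₀ t A, (if R < dist (q : E3) c₀ then 38 * (dist (q : E3) (t 0 + A z₀))⁻¹ ^ 8 * ‖h q‖ else 0) ≤
      38 * Real.sqrt (1024 / ((23 / 25 : ℝ) ^ 3 * (R - 11 / 10) ^ 5)) * Real.sqrt (39 * J) := by
  have hR' : 23 / 25 ≤ R - 11 / 10 := by linarith
  obtain ⟨hf8s, hf8le⟩ := summable_far_inv_pow_eight_sites hA hI (t 0 + A z₀) hR'
  have hfinh : Set.Finite {q : Sites₀ t A | h q ≠ 0} := finite_support_sites hh
  have hbhsupp : ∀ q ∉ hfinh.toFinset,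
      (if R < dist (q : E3) c₀ then 38 * (dist (q : E3) (t 0 + A z₀))⁻¹ ^ 8 * ‖h q‖ else 0) = 0 := by
    intro q hq
    rw [Set.Finite.mem_toFinset] at hq
    have : h q = 0 := not_not.1 hq
    rw [this, norm_zero, mul_zero]; simp
  refine ⟨summable_of_ne_finset_zero hbhsupp, ?_⟩
  rw [tsum_eq_sum hbhsupp]
  have hαβ : ∀ q ∈ hfinh.toFinset,
      (if R < dist (q : E3) c₀ then 38 * (dist (q : E3) (t 0 + A z₀))⁻¹ ^ 8 * ‖h q‖ else 0) = 38 *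
      ((if R < dist (q : E3) c₀ then (dist (q : E3) (t 0 + A z₀))⁻¹ ^ 4 else 0) *
        ((if R < dist (q : E3) c₀ then (dist (q : E3) (t 0 + A z₀))⁻¹ ^ 4 else 0) * ‖h q‖)) := by
    intro q _
    split_ifs <;> ring
  rw [Finset.sum_congr rfl hαβ, ← Finset.mul_sum, mul_assoc]
  refine mul_le_mul_of_nonneg_left ((sum_mul_le_sqrt_mul_sqrt _ _ _).trans ?_) (by norm_num)
  refine mul_le_mul (Real.sqrt_le_sqrt ?_) (Real.sqrt_le_sqrt ?_) (Real.sqrt_nonneg _) (Real.sqrt_nonneg _)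
  · calc ∑ q ∈ hfinh.toFinset, (if R < dist (q : E3) c₀ then (dist (q : E3) (t 0 + A z₀))⁻¹ ^ 4 else 0) ^ 2
        ≤ ∑ q ∈ hfinh.toFinset, (if R - 11 / 10 < dist (q : E3) (t 0 + A z₀) then (dist (q : E3) (t 0 + A z₀))⁻¹ ^ 8 else 0) := by
          refine Finset.sum_le_sum fun q _ => ?_
          by_cases hfar : R < dist (q : E3) c₀
          · have hdf : R - 11 / 10 < dist (q : E3) (t 0 + A z₀) := by
              have := dist_triangle (q : E3) (t 0 + A z₀) c₀; linarith
            rw [if_pos hfar, if_pos hdf, ← pow_mul]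
          · rw [if_neg hfar]; simp only [ne_eq, OfNat.ofNat_ne_zero, not_false_eq_true, zero_pow]; positivity
      _ ≤ _ := hf8s.sum_le_tsum _ (fun q _ => by positivity)
      _ ≤ _ := hf8le
  · have hsJ : Summable (fun q : Sites₀ t A => ‖h q‖ ^ 2 * (max (dist (q : E3) c₀) R)⁻¹ ^ 8) := by
      refine summable_of_ne_finset_zero (s := hfinh.toFinset) fun q hq => ?_
      rw [Set.Finite.mem_toFinset] at hq
      rw [not_not.1 hq, norm_zero]; ring
    calc ∑ q ∈ hfinh.toFinset, ((if R < dist (q : E3) c₀ then (dist (q : E3) (t 0 + A z₀))⁻¹ ^ 4 else 0) * ‖h q‖) ^ 2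
        ≤ ∑ q ∈ hfinh.toFinset, 39 * (‖h q‖ ^ 2 * (max (dist (q : E3) c₀) R)⁻¹ ^ 8) := by
          refine Finset.sum_le_sum fun q _ => ?_
          by_cases hfar : R < dist (q : E3) c₀
          · rw [if_pos hfar, max_eq_left hfar.le]
            have hD0 : 0 < dist (q : E3) c₀ := by linarith
            have hdD : 19 / 30 * dist (q : E3) c₀ ≤ dist (q : E3) (t 0 + A z₀) := by
              have := dist_triangle (q : E3) (t 0 + A z₀) c₀; linarith
            have hd0 : 0 < dist (q : E3) (t 0 + A z₀) := by linarith
            have hinv : (dist (q : E3) (t 0 + A z₀))⁻¹ ≤ 30 / 19 * (dist (q : E3) c₀)⁻¹ := by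
              rw [inv_le_comm₀ hd0 (by positivity), mul_inv, inv_inv]
              calc (30 / 19 : ℝ)⁻¹ * dist (q : E3) c₀ = 19 / 30 * dist (q : E3) c₀ := by norm_num
                _ ≤ _ := hdD
            have hi0 : 0 ≤ (dist (q : E3) (t 0 + A z₀))⁻¹ := inv_nonneg.2 hd0.le
            calc ((dist (q : E3) (t 0 + A z₀))⁻¹ ^ 4 * ‖h q‖) ^ 2 = ((dist (q : E3) (t 0 + A z₀))⁻¹) ^ 8 * ‖h q‖ ^ 2 := by ring
              _ ≤ (30 / 19 * (dist (q : E3) c₀)⁻¹) ^ 8 * ‖h q‖ ^ 2 := by gcongr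
              _ = (30 / 19 : ℝ) ^ 8 * (‖h q‖ ^ 2 * (dist (q : E3) c₀)⁻¹ ^ 8) := by ring
              _ ≤ 39 * (‖h q‖ ^ 2 * (dist (q : E3) c₀)⁻¹ ^ 8) := by gcongr; norm_num
          · rw [if_neg hfar, zero_mul]; simp only [ne_eq, OfNat.ofNat_ne_zero, not_false_eq_true, zero_pow]
            positivity
      _ = 39 * ∑ q ∈ hfinh.toFinset, ‖h q‖ ^ 2 * (max (dist (q : E3) c₀) R)⁻¹ ^ 8 := by rw [Finset.mul_sum]
      _ ≤ 39 * J := by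
          refine mul_le_mul_of_nonneg_left ((hsJ.sum_le_tsum _ (fun q _ => by positivity)).trans hJ) (by norm_num)

end

end Summit.AtomisticToContinuum.Crystallization.Theorems.ExcessDecayLiouville

end
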